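import Literature.MathematicalPhysics.QuantumFieldTheory.Federbush1986.Regime2CombLargeN
import Literature.MathematicalPhysics.QuantumFieldTheory.Federbush1986.PureAveragesSU2Lemma11
import Literature.MathematicalPhysics.QuantumFieldTheory.Federbush1986.PureAveragesSU2Lemma13
import Literature.MathematicalPhysics.QuantumFieldTheory.Federbush1986.PureAveragesSU2Existence

/-!
# Federbush, *A phase cell approach to Yang–Mills theory* III [Federbush1987PhaseCellIII] — Local Stability Theorem 4.2 (p. 299)
# at the tree's MODEL INSTANCE `G = SU(2)` of print's group («We let G be a compact Lie Group and d(·,·) an invariant distance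
# constructed from an invariant metric on G», §1 p. 294): the four-dimensional comb scheme's Theorem 4.2 with the chart hypotheses
# DISCHARGED by the tree's SU(2) theorems (Lemma 1.1 `SU2.lemma11_SU2`, Lemma 1.3 `SU2.lemma13_SU2`, the chart `SU2.localLog`,
# compactness `SU2.compactSpace`) — and (v1.1) the l.f. bookkeeping of `A_{l.f.}` DISCHARGED from print's redistribution rule (p. 298)

statement-level skeleton of published theorems with citation tags; proofs where landed; nothing here is a claim about the Yang–Mills mass gap

PDF held: HELD-LOCAL L03 (`run/shared/lean/pub/pub-balaban/t4/b2b-balaban-t4-lit2/pdf/fed1987-cmp110-III.pdf`, journal page =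
PDF page + 292); pages READ AS IMAGES (renders `run/shared/lean/pub/lit-balaban/lit-balaban-p32/renders/fed1987-cmp110-III-p002-half.png`,
`-p006-half.png`, `-p007-half.png`, `-p013-half.png`): p. 294 (§1: «G … a compact Lie Group», the invariant distance `d(·,·)`, the
identity `ε`), p. 298 (§4: s.f./l.f., «hit», `A_{l.f.}`, the regimes, «absolute number r₁»), p. 299 (Theorem 4.2), p. 305 (step 10)).

THE PRINT (p. 294, §1): *«We let G be a compact Lie Group and d(·,·) an invariant distance constructed from an invariant metric on
G. ε will denote the identity, and we consider elements g = e^A that are sufficiently close to the identity, with |A| sufficiently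
small.»*  `SU(2)` is NOT singled out anywhere in [F-III] (whole-paper check, v1.2 RECORDS below); it is the tree's model instance of
print's `G`, used here because Lemma 1.1, Lemma 1.3 and compactness are tree theorems for it.

THE PRINT (p. 298): *«A plaquette p is s.f. if |A_{∂p}| < a (more properly, |g_{∂p}| < a, with definition at beginning of Sect. 5)
and l.f. if |A_{∂p}| ≧ a. Each vertex of a plaquette p at level s is contained in one N⁴ size block, a vertex in the level s − 1
lattice; it is said to hit this vertex. A plaquette p at level s is said to hit a bond or plaquette of the s − 1 lattice if it
hits a vertex of this bond or plaquette.»* … *«If one half the action, ½a², of a l.f. plaquette is distributed equally among all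
the plaquettes it hits, A_{l.f.}(p) is the action associated to p by this process.»* … *«We also consider exactly those plaquettes
{p_i}_{i∈P} in the level r + 1 all of whose vertices lie in the four N⁴ size blocks, vertices of the plaquette P. This is a
smaller set of p_i than hit P.»* … *«Regime 2. Some of the p_i are l.f., but A_{l.f.}(P) < 3a². Regime 3. A_{l.f.}(P) ≧ 3a².
We note there is an absolute number r₁ such that if more than r₁ p_i are l.f., we are in Regime 3.»*; (p. 299): *«Local Stability
Theorem 4.2. There is a number f₁ > 0 such that in Regime 2, Δ̃S(P) ≧ f₁a². (4.4)»* … *«All these results will hold for suitable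
fixed N, c_d, f₁, f₂, and a₀, where a must satisfy a < a₀.»*

CITATION HEADER (lean-in-tree rule).  lit-balaban cell (HOME `run/shared/lean/pub/lit-balaban/`), Phase-2 proof seat p32 gen 14,
v1.1 gen 15; SKELETON row **F3.Thm4.2** (owner r17, head `typed`); HOME/lit-balaban-p32/CAPSTONE-PLAN.md NOTE 7.  This file
specialises `Regime2CombLargeN.exists_cd_N₀_localStabilityTheorem42_of_lemmas` to `G = SU(2)` with the tree's chart `SU2.localLog`
(`LocalLogChart`: `exp = expSU2`, `ρ = 1/4`, `K = 2`), for which Lemma 1.1 and Lemma 1.3 are tree theorems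
(`PureAveragesSU2Lemma11.SU2.lemma11_SU2`, `PureAveragesSU2Lemma13.SU2.lemma13_SU2`) and `SU(2)` is compact
(`PureAveragesSU2Existence.SU2.compactSpace`).  In v1.0 the l.f. bookkeeping print builds into `A_{l.f.}` stayed hypothetical (the
hit bound `h·a² ≦ A_lf` and `≦ r₁` l.f. plaquettes when `A_lf < 3a²`).  **v1.1 (gen 15) DISCHARGES IT from print's redistribution
rule:** every l.f. `p_i` (all vertices in the four blocks) hits `P`, and hits at most an absolute number `m` of level-`r`
plaquettes (the tree's typing of §4, `LocalStabilityHits` — p32 gen 7: `Hits.card_hitSet_le`, `m = 16·dim² = 256` in dimension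
four), hence receives from print's process at least `½a²/m` per inside l.f. plaquette: the SHARE BOUND
`#{l.f. p_i}·a²/(2m) ≦ A_{l.f.}(P)`.  Under the share bound alone, the hit bound holds with `h = 1/(2m)` (`hit_of_lfShare`) and
«if more than r₁ p_i are l.f., we are in Regime 3» with `r₁ = 6m − 1` (`card_lfSet_le_of_lfShare`) — print's «absolute number
r₁».  Here `m` stays a parameter and the share bound a hypothesis on `A_lf` (any `A_lf ≧` the inside shares, e.g.
`insideShare + E` with `E ≧ 0`, `exists_cd_N₀_localStabilityTheorem42_sharePlus`); r17's companion `LocalStabilityThm42PrintedAlf`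
(gen 15, filed in parallel) DERIVES the share bound with `m = 16·4²` for print's concrete `A_{l.f.}(P)` built from `Hits.Alf` (its `alfIn` /
`alfFull`) from the hit combinatorics of `LocalStabilityHits`, and carries the exterior l.f. data in the configuration for print's quantifier
order.  Companions BY NAME (none edited): the files just named, `Regime2CombCapstone`, `Regime2CombScheme` (`familyC`,
`lfSet`, `plaqHol`), `LocalStabilityThm42ModelInstances` (r17: the model-instance one-liners
`LocalStabilityG.exists_cd_N₀_localStabilityTheorem42_UN/_H/_SUN/_closed` of `_of_lemmas`; its v1.1 imports this module for `_SU2`).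

v1.1 RECORDS (gen 15).  (i) N-g56-1 (ref-5 gen 56: v1.0's `LocalStabilityG.exists_cd_N₀_localStabilityTheorem42_SU2` and r17's
`LocalStabilityThm42ModelInstances` §2 (p336816) declared the same fully qualified name, so no module could import both) is
RESOLVED ON r17's SIDE: `LocalStabilityThm42ModelInstances` v1.1 retired its copy and imports this module; the theorem here is
UNCHANGED (name and statement byte-identical to v1.0 — the name of record, binder-free).  (ii) Header slip «head `absent`» →
`typed` (ref-5 gen 55/56).  (iii) New theorems, all in `LocalStabilityG`: `card_pos_lfSet_of_lf`, `hit_of_lfShare`,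
`card_lfSet_le_of_lfShare`, `exists_cd_N₀_localStabilityTheorem42_of_lfShare`, `exists_cd_N₀_localStabilityTheorem42_sharePlus`
(general compact `G`, Lemmas 1.1/1.3 as hypotheses on the chart) and `exists_cd_N₀_localStabilityTheorem42_SU2_of_lfShare`,
`exists_cd_N₀_localStabilityTheorem42_SU2_sharePlus` (`G = SU(2)`: the only data left are the absolute hit number `m` and the share
bound / the outside shares `E ≧ 0`).

v1.2 RECORDS (gen 16; DOC-ONLY — every declaration and every declaration docstring byte-identical to v1.1).  The v1.0/v1.1 module
title attributed to p. 294 a sentence «We will work with the group SU(2), to be specific» that [F-III] does NOT print (r17 gen 15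
QUOTE-CLASS NOTE 2026-08-22: render `fed1987-cmp110-III-p002-half.png` read as image, text layer `paper:url-4700a514f365` grep
«SU(2)|specific» 0 hits over all 18 pages; re-checked by p32 gen 16 the same way).  Print's group is a general compact Lie group `G`
with an invariant distance (§1 p. 294, quoted above); `SU(2)` is the tree's model instance of it.  The title, the page list and the
«THE PRINT (p. 294, §1)» paragraph are corrected accordingly; nothing else changed.

WHAT IS PROVED.  **`exists_cd_N₀_localStabilityTheorem42_SU2`** (v1.0) — for every `r₁` and `h > 0`: `∃ c_d > 0, ∃ N₀, ∀ N ≧ N₀`,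
for every l.f. action on the `SU(2)` configurations of the four blocks with the hit bound and `≦ r₁` l.f. plaquettes in Regime 2,
`LocalStabilityTheorem42 (familyC 2 N hN r₁ c_d A_lf)`.  **`exists_cd_N₀_localStabilityTheorem42_of_lfShare`** (general `G`) and
**`exists_cd_N₀_localStabilityTheorem42_SU2_of_lfShare`** — for every absolute hit number `m ≧ 1`: `∃ c_d > 0, ∃ N₀, ∀ N ≧ N₀`,
for every l.f. action `A_lf ≧ 0` obeying the share bound `#lfSet·a²/(2m) ≦ A_lf`, `LocalStabilityTheorem42 (familyC 2 N hN
(6m − 1) c_d A_lf)`; **`…_sharePlus`** — the same for `A_lf = #lfSet·a²/(2m) + E`, every `E ≧ 0`.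

HONEST SCOPE.  Specialisations and elementary bookkeeping; Theorem 4.2 for the TREE'S comb rendering of the Regime-2 construction at
`G = SU(2)` (HOME/GAPS.md G-F3-p32-08); in this file the level-`r` hit number `m` is a parameter and the share bound a hypothesis
(derived for print's concrete `A_{l.f.}` in r17's `LocalStabilityThm42PrintedAlf`); not a claim about the Yang–Mills mass gap.  Theorems only, no new
definitions, no sorry; axioms standard.  Unit `lit-balaban-p32` (literature-prover-lit-balaban-p32-g14-0; v1.1
literature-prover-lit-balaban-p32-g15-0; v1.2 doc-only literature-prover-lit-balaban-p32-g16-0).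
-/

noncomputable section

namespace Literature.MathematicalPhysics.QuantumFieldTheory.Federbush1986

namespace LocalStabilityG

open scoped BigOperators

section AlfBookkeeping

variable {G : Type} [Group G] [MetricSpace G] [CompactSpace G] (d N : ℕ) (hN : 0 < N)

omit [CompactSpace G] in
/-- An l.f. fine plaquette («l.f. if |A_{∂p}| ≧ a») is a member of `lfSet`, so «Some of the p_i are l.f.» gives `#lfSet ≧ 1`.
[cite: Federbush1987PhaseCellIII, §4 p. 298] -/
theorem card_pos_lfSet_of_lf (a : ℝ) (U : Cfg G d N) (hj : ∃ j, a ≤ dist 1 (plaqHol d N hN U j)) :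
    0 < (lfSet d N hN a U).card := by
  obtain ⟨j, hj⟩ := hj
  exact Finset.card_pos.mpr ⟨j, Finset.mem_filter.mpr ⟨Finset.mem_univ _, hj⟩⟩

omit [CompactSpace G] in
/-- **The hit bound from print's redistribution rule.** «If one half the action, ½a², of a l.f. plaquette is distributed equally
among all the plaquettes it hits, A_{l.f.}(p) is the action associated to p by this process»: each l.f. `p_i` (all vertices in
the four blocks, so it hits `P`) hits at most `m` plaquettes of level `r`, hence under the SHARE BOUND `#lfSet·a²/(2m) ≦ A_lf`
one l.f. `p_i` forces `A_lf ≧ a²/(2m)`: the hit bound with `h = 1/(2m)` (the Regime-2 condition `A_lf < 3a²` is not needed).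
[cite: Federbush1987PhaseCellIII, §4 p. 298] -/
theorem hit_of_lfShare {m : ℕ} (hm : 0 < m) (Alf : ℝ → Cfg G d N → ℝ)
    (hshare : ∀ a : ℝ, 0 < a → ∀ U : Cfg G d N, ((lfSet d N hN a U).card : ℝ) * (a ^ 2 / (2 * m)) ≤ Alf a U) :
    ∀ a : ℝ, 0 < a → ∀ U : Cfg G d N, (∃ j, a ≤ dist 1 (plaqHol d N hN U j)) → Alf a U < 3 * a ^ 2 →
      1 / (2 * (m : ℝ)) * a ^ 2 ≤ Alf a U := by
  intro a ha U hj _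
  have hcard : (1 : ℝ) ≤ (lfSet d N hN a U).card := by exact_mod_cast card_pos_lfSet_of_lf d N hN a U hj
  have hm' : (0 : ℝ) < 2 * (m : ℝ) := by positivity
  have hq : 0 ≤ a ^ 2 / (2 * (m : ℝ)) := by positivity
  calc 1 / (2 * (m : ℝ)) * a ^ 2 = 1 * (a ^ 2 / (2 * m)) := by ring
    _ ≤ ((lfSet d N hN a U).card : ℝ) * (a ^ 2 / (2 * m)) := mul_le_mul_of_nonneg_right hcard hq
    _ ≤ Alf a U := hshare a ha U

omit [CompactSpace G] in
/-- **«We note there is an absolute number r₁ such that if more than r₁ p_i are l.f., we are in Regime 3»** — from the share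
bound: `A_lf < 3a²` (Regime 2) and `#lfSet·a²/(2m) ≦ A_lf` give `#lfSet < 6m`, i.e. `#lfSet ≦ r₁ := 6m − 1`.
[cite: Federbush1987PhaseCellIII, §4 p. 298] -/
theorem card_lfSet_le_of_lfShare {m : ℕ} (hm : 0 < m) (Alf : ℝ → Cfg G d N → ℝ)
    (hshare : ∀ a : ℝ, 0 < a → ∀ U : Cfg G d N, ((lfSet d N hN a U).card : ℝ) * (a ^ 2 / (2 * m)) ≤ Alf a U) :
    ∀ a : ℝ, 0 < a → ∀ U : Cfg G d N, Alf a U < 3 * a ^ 2 → (lfSet d N hN a U).card ≤ 6 * m - 1 := by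
  intro a ha U hlt
  have hm' : (0 : ℝ) < 2 * (m : ℝ) := by positivity
  have h1 : ((lfSet d N hN a U).card : ℝ) * (a ^ 2 / (2 * m)) < 3 * a ^ 2 := lt_of_le_of_lt (hshare a ha U) hlt
  have h2 : ((lfSet d N hN a U).card : ℝ) * a ^ 2 < (6 * m : ℝ) * a ^ 2 := by
    rw [mul_div_assoc'] at h1
    rw [div_lt_iff₀ hm'] at h1
    linarith
  have h3 : ((lfSet d N hN a U).card : ℝ) < 6 * m := lt_of_mul_lt_mul_right h2 (by positivity)
  have h4 : (lfSet d N hN a U).card < 6 * m := by exact_mod_cast h3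
  omega

variable [IsIsometricSMul G G] [IsIsometricSMul Gᵐᵒᵖ G]
variable {𝔤 : Type*} [NormedAddCommGroup 𝔤] [InnerProductSpace ℝ 𝔤] (L : LocalLog G 𝔤)

/-- **Theorem 4.2 for the four-dimensional comb scheme under the share bound alone** (general compact `G`; §1's Lemmas 1.1 and
1.3 as hypotheses on the chart): for every absolute hit number `m ≧ 1` there are `c_d > 0` and `N₀` such that for all `N ≧ N₀`
and all l.f. actions `A_lf ≧ 0` obeying print's redistribution share bound `#lfSet·a²/(2m) ≦ A_lf`, the family
`familyC 2 N hN (6m − 1) c_d A_lf` satisfies Local Stability Theorem 4.2 — the hit bound (`h = 1/(2m)`) and «≦ r₁ l.f. in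
Regime 2» (`r₁ = 6m − 1`) being consequences (`hit_of_lfShare`, `card_lfSet_le_of_lfShare`).
[cite: Federbush1987PhaseCellIII, Theorem 4.2 (4.4) p. 299; §4 p. 298; §5.3 10) p. 305] -/
theorem exists_cd_N₀_localStabilityTheorem42_of_lfShare (h11 : Lemma11 L.exp) (h13 : Lemma13 L.exp) {m : ℕ} (hm : 0 < m) :
    ∃ cd : ℝ, 0 < cd ∧ ∃ N₀ : ℕ, ∀ (N : ℕ) (hN : 0 < N), N₀ ≤ N →
      ∀ (Alf : ℝ → Cfg G 2 N → ℝ) (hAlf : ∀ a U, 0 ≤ Alf a U),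
        (∀ a : ℝ, 0 < a → ∀ U : Cfg G 2 N, ((lfSet 2 N hN a U).card : ℝ) * (a ^ 2 / (2 * m)) ≤ Alf a U) →
        TwoLevelScheme.LocalStabilityTheorem42 (familyC 2 N hN (6 * m - 1) cd Alf hAlf) := by
  have hh : (0 : ℝ) < 1 / (2 * (m : ℝ)) := by positivity
  obtain ⟨cd, hcd, N₀, H⟩ := exists_cd_N₀_localStabilityTheorem42_of_lemmas L h11 h13 (6 * m - 1) hh
  refine ⟨cd, hcd, N₀, fun N hN hN₀ Alf hAlf hshare => ?_⟩
  exact H N hN hN₀ Alf hAlf (hit_of_lfShare 2 N hN hm Alf hshare) (card_lfSet_le_of_lfShare 2 N hN hm Alf hshare)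

/-- **Theorem 4.2 for the four-dimensional comb scheme with `A_lf` = inside shares + outside shares** (general compact `G`;
Lemmas 1.1 and 1.3 as hypotheses on the chart): with `A_lf(P) = #lfSet·a²/(2m) + E`, `E ≧ 0` arbitrary (the shares print's process
assigns to `P` from l.f. plaquettes not inside the four blocks, and the excess of a plaquette hitting fewer than `m` plaquettes),
the family satisfies Theorem 4.2 for all `N ≧ N₀`, `r₁ = 6m − 1`. [cite: Federbush1987PhaseCellIII, Theorem 4.2 (4.4) p. 299;
§4 p. 298] -/
theorem exists_cd_N₀_localStabilityTheorem42_sharePlus (h11 : Lemma11 L.exp) (h13 : Lemma13 L.exp) {m : ℕ} (hm : 0 < m) :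
    ∃ cd : ℝ, 0 < cd ∧ ∃ N₀ : ℕ, ∀ (N : ℕ) (hN : 0 < N), N₀ ≤ N →
      ∀ (E : ℝ → Cfg G 2 N → ℝ) (hE : ∀ a U, 0 ≤ E a U),
        TwoLevelScheme.LocalStabilityTheorem42 (familyC 2 N hN (6 * m - 1) cd
          (fun a U => ((lfSet 2 N hN a U).card : ℝ) * (a ^ 2 / (2 * m)) + E a U)
          (fun a U => add_nonneg (mul_nonneg (Nat.cast_nonneg _) (by positivity)) (hE a U))) := by
  obtain ⟨cd, hcd, N₀, H⟩ := exists_cd_N₀_localStabilityTheorem42_of_lfShare L h11 h13 hm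
  refine ⟨cd, hcd, N₀, fun N hN hN₀ E hE => H N hN hN₀ _ _ ?_⟩
  intro a _ U
  exact le_add_of_nonneg_right (hE a U)

end AlfBookkeeping

section SU2Instance

attribute [local instance] SU2.compactSpace in
/-- **Local Stability Theorem 4.2 for the four-dimensional comb scheme over `SU(2)`**, «for suitable fixed N, c_d», with §1's
Lemmas 1.1 and 1.3 supplied by the tree's `SU(2)` theorems: for every `r₁` and hit constant `h > 0` there are `c_d > 0` and `N₀`
such that for all `N ≧ N₀` and all l.f. actions `A_lf ≧ 0` with `h·a² ≦ A_lf` and `≦ r₁` l.f. plaquettes whenever `A_lf < 3a²`,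
the family `familyC 2 N hN r₁ c_d A_lf` of `SU(2)` comb schemes satisfies Theorem 4.2 (4.4).
[cite: Federbush1987PhaseCellIII, Theorem 4.2 (4.4) p. 299; §1 p. 294–295; §5.3 10) p. 305] -/
theorem exists_cd_N₀_localStabilityTheorem42_SU2 (r₁ : ℕ) {h : ℝ} (hh : 0 < h) :
    ∃ cd : ℝ, 0 < cd ∧ ∃ N₀ : ℕ, ∀ (N : ℕ) (hN : 0 < N), N₀ ≤ N →
      ∀ (Alf : ℝ → Cfg SU2 2 N → ℝ) (hAlf : ∀ a U, 0 ≤ Alf a U),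
        (∀ a : ℝ, 0 < a → ∀ U : Cfg SU2 2 N, (∃ j, a ≤ dist 1 (plaqHol 2 N hN U j)) → Alf a U < 3 * a ^ 2 →
          h * a ^ 2 ≤ Alf a U) →
        (∀ a : ℝ, 0 < a → ∀ U : Cfg SU2 2 N, Alf a U < 3 * a ^ 2 → (lfSet 2 N hN a U).card ≤ r₁) →
        TwoLevelScheme.LocalStabilityTheorem42 (familyC 2 N hN r₁ cd Alf hAlf) :=
  exists_cd_N₀_localStabilityTheorem42_of_lemmas SU2.localLog SU2.lemma11_SU2 SU2.lemma13_SU2 r₁ hh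

attribute [local instance] SU2.compactSpace in
/-- **Local Stability Theorem 4.2 for the four-dimensional comb scheme over `SU(2)` under the share bound alone**: for every
absolute hit number `m ≧ 1` there are `c_d > 0` and `N₀` such that for all `N ≧ N₀` and every l.f. action `A_lf ≧ 0` obeying
print's redistribution share bound `#lfSet·a²/(2m) ≦ A_lf` («one half the action, ½a², of a l.f. plaquette is distributed equally
among all the plaquettes it hits»), the family `familyC 2 N hN (6m − 1) c_d A_lf` of `SU(2)` comb schemes satisfies Theorem 4.2
(4.4); Lemma 1.1, Lemma 1.3, compactness, the hit bound and «≦ r₁ l.f.» are all tree theorems here.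
[cite: Federbush1987PhaseCellIII, Theorem 4.2 (4.4) p. 299; §4 p. 298; §1 p. 294–295] -/
theorem exists_cd_N₀_localStabilityTheorem42_SU2_of_lfShare {m : ℕ} (hm : 0 < m) :
    ∃ cd : ℝ, 0 < cd ∧ ∃ N₀ : ℕ, ∀ (N : ℕ) (hN : 0 < N), N₀ ≤ N →
      ∀ (Alf : ℝ → Cfg SU2 2 N → ℝ) (hAlf : ∀ a U, 0 ≤ Alf a U),
        (∀ a : ℝ, 0 < a → ∀ U : Cfg SU2 2 N, ((lfSet 2 N hN a U).card : ℝ) * (a ^ 2 / (2 * m)) ≤ Alf a U) →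
        TwoLevelScheme.LocalStabilityTheorem42 (familyC 2 N hN (6 * m - 1) cd Alf hAlf) :=
  exists_cd_N₀_localStabilityTheorem42_of_lfShare SU2.localLog SU2.lemma11_SU2 SU2.lemma13_SU2 hm

attribute [local instance] SU2.compactSpace in
/-- **Local Stability Theorem 4.2 for the four-dimensional comb scheme over `SU(2)`, `A_lf` = inside shares + outside shares**:
for every absolute hit number `m ≧ 1` there are `c_d > 0` and `N₀` such that for all `N ≧ N₀` and every `E ≧ 0`, the family with
`A_lf(P) = #lfSet·a²/(2m) + E` and `r₁ = 6m − 1` satisfies Theorem 4.2 (4.4).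
[cite: Federbush1987PhaseCellIII, Theorem 4.2 (4.4) p. 299; §4 p. 298] -/
theorem exists_cd_N₀_localStabilityTheorem42_SU2_sharePlus {m : ℕ} (hm : 0 < m) :
    ∃ cd : ℝ, 0 < cd ∧ ∃ N₀ : ℕ, ∀ (N : ℕ) (hN : 0 < N), N₀ ≤ N →
      ∀ (E : ℝ → Cfg SU2 2 N → ℝ) (hE : ∀ a U, 0 ≤ E a U),
        TwoLevelScheme.LocalStabilityTheorem42 (familyC 2 N hN (6 * m - 1) cd
          (fun a U => ((lfSet 2 N hN a U).card : ℝ) * (a ^ 2 / (2 * m)) + E a U)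
          (fun a U => add_nonneg (mul_nonneg (Nat.cast_nonneg _) (by positivity)) (hE a U))) :=
  exists_cd_N₀_localStabilityTheorem42_sharePlus SU2.localLog SU2.lemma11_SU2 SU2.lemma13_SU2 hm

end SU2Instance

end LocalStabilityG

end Literature.MathematicalPhysics.QuantumFieldTheory.Federbush1986
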